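import Mathlib
import Summits.KontsevichZagierPeriods.KontsevichZagierPeriods.Theorems.InverseLandauTateLiftingSqrtReduce
import Summits.KontsevichZagierPeriods.KontsevichZagierPeriods.Theorems.TerasomaMultiplicationBetaCancellationStubAffineMove

/-!
# `TateLifting` (stmt-KontsevichZagierPeriods-9129), line `Sketch` — stub 37 `tateLifting_sqrtAffineReduce`

THE EULER REDUCTION OF `ℚ̄(x, √(ax + b))`-INTEGRANDS (all parabolas `y² = ax + b`). Let
`K = ℚ̄ ∩ ℝ = algebraicClosure ℚ ℝ` be the field of real algebraic numbers, `a, b ∈ K`, `a > 0`,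
and let `r = [σ, R(x, √(ax + b))]` be a one-dimensional representation with `ax + b > 0` on `σ`,
whose integrand is, on `σ`, the value at `(x, √(ax + b))` of a rational function `R = P/Q`,
`P, Q ∈ K[X₀, X₁]`, `Q(x, √(ax + b)) ≠ 0` on `σ`. ONE affine move `u = Φ(x) = ax + b`
(Kontsevich–Zagier's rule (2), `KZ.changeOfVariablesRel`) pushes `r` forward to the honest
representation

* `r₁ = [Φ(σ), a⁻¹ · f(a⁻¹ u − b a⁻¹)]`, `f = r.integrand`,

(`SqrtAffineReduce.ar_pushforward`: the domain `Φ(σ)` is the image of a semialgebraic set under a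
semialgebraic map with real-algebraic coefficients, the integrand is a real-algebraic constant
times the composite of `f` with the inverse chart `Ψ(u) = a⁻¹ u − b a⁻¹`, and it is absolutely
integrable by Mathlib's Jacobian criterion along `Φ`, `|det Φ'| = a`), with `[r] − [r₁] ∈ KZ.relations`.
On `Φ(σ) ⊆ (0, ∞)` the integrand of `r₁` is `P'(u, √u)/Q'(u, √u)` for the substituted polynomials
`P' = a⁻¹ · P(a⁻¹ X₀ − b a⁻¹, X₁)`, `Q' = Q(a⁻¹ X₀ − b a⁻¹, X₁) ∈ K[X₀, X₁]`
(`SqrtAffineReduce.ar_aeval_bind₁`), so the landed Euler reduction of `ℚ̄(u, √u)`-integrands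
(`tateLifting_sqrtReduce`, stub 35) finishes: `[r₁] − [ρ] ∈ KZ.relations` with `ρ` read by real
polynomials `p/q` with real-algebraic coefficients, and `[r] − [ρ] = ([r] − [r₁]) + ([r₁] − [ρ])`.

References: M. Kontsevich, D. Zagier, *Periods* (2001), §1.2 rule (2).
-/

noncomputable section

open MeasureTheory Set
open Literature.NumberTheory.Transcendental
open Literature.ModelTheory.ExponentialFields (IsSemialgebraic)
open MvPolynomial (aeval X C bind₁)
open Summit.KontsevichZagierPeriods.KontsevichZagierPeriods.BetaCancellationLine
  (aff_hasFDerivAt_chart aff_abs_det_chartDeriv aff_injective_chart aff_isSemialgebraicMapOn_chart)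

namespace Summit.KontsevichZagierPeriods.InverseLandau

namespace SqrtAffineReduce

/-- The inverse chart `Ψ(u) = α⁻¹ u − β α⁻¹` undoes the affine chart `Φ(t) = α t + β` (`α ≠ 0`),
on the coordinate. [folklore] -/
theorem ar_inv_chart_apply {α : ℝ} (hα : α ≠ 0) (β t : ℝ) :
    α⁻¹ * (α * t + β) + -(β * α⁻¹) = t := by
  field_simp
  ring

/-- The inverse chart `Ψ(u) = α⁻¹ u − β α⁻¹` undoes the affine chart `Φ(t) = α t + β` (`α ≠ 0`),
on points of `ℝ¹`. [folklore] -/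
theorem ar_inv_chart {α : ℝ} (hα : α ≠ 0) (β : ℝ) (x : Fin 1 → ℝ) :
    (fun _ : Fin 1 => α⁻¹ * (α * x 0 + β) + -(β * α⁻¹)) = x := by
  funext i
  obtain rfl : i = 0 := Fin.fin_one_eq_zero i
  exact ar_inv_chart_apply hα β (x 0)

/-- The image `Φ(σ)` of a `ℚ`-semialgebraic `σ ⊆ ℝ¹` under the affine chart `Φ(t) = α t + β` with
real-algebraic `α, β` is `ℚ`-semialgebraic: image of a semialgebraic set under a semialgebraic map
(Tarski–Seidenberg, `IsSemialgebraicMapOn.isSemialgebraic_image_holds`). [folklore] -/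
theorem ar_isSemialgebraic_image {σ : Set (Fin 1 → ℝ)} (hσ : IsSemialgebraic ℚ σ) {α β : ℝ}
    (hαa : IsAlgebraic ℚ α) (hβa : IsAlgebraic ℚ β) :
    IsSemialgebraic ℚ ((fun y : Fin 1 → ℝ => fun _ : Fin 1 => α * y 0 + β) '' σ) :=
  IsSemialgebraicMapOn.isSemialgebraic_image_holds (aff_isSemialgebraicMapOn_chart hσ hβa hαa)
    Subset.rfl hσ

/-- The pushed-forward integrand `u ↦ α⁻¹ · f(Ψ u)`, `Ψ(u) = α⁻¹ u − β α⁻¹`, is `ℚ`-semialgebraic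
on `Φ(σ)` whenever `f` is `ℚ`-semialgebraic on `σ` (`α ≠ 0`, `α, β` real algebraic): a
real-algebraic constant times the composite of `f` with the semialgebraic map `Ψ`, `Ψ(Φ(σ)) ⊆ σ`
(Tarski–Seidenberg). [folklore] -/
theorem ar_isSemialgebraicFunOn {σ : Set (Fin 1 → ℝ)} {f : (Fin 1 → ℝ) → ℝ}
    (hσ : IsSemialgebraic ℚ σ) (hf : IsSemialgebraicFunOn ℚ σ f) {α β : ℝ} (hα : α ≠ 0)
    (hαa : IsAlgebraic ℚ α) (hβa : IsAlgebraic ℚ β) :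
    IsSemialgebraicFunOn ℚ ((fun y : Fin 1 → ℝ => fun _ : Fin 1 => α * y 0 + β) '' σ)
      (fun u => α⁻¹ * f (fun _ => α⁻¹ * u 0 + -(β * α⁻¹))) := by
  have hσ₁ := ar_isSemialgebraic_image hσ hαa hβa
  have hαi : IsAlgebraic ℚ α⁻¹ := hαa.inv
  have hc : IsAlgebraic ℚ (-(β * α⁻¹)) := (hβa.mul hαi).neg
  have hmaps : MapsTo (fun u : Fin 1 → ℝ => fun _ : Fin 1 => α⁻¹ * u 0 + -(β * α⁻¹))
      ((fun y : Fin 1 → ℝ => fun _ : Fin 1 => α * y 0 + β) '' σ) σ := by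
    rintro _ ⟨x, hx, rfl⟩
    show (fun _ : Fin 1 => α⁻¹ * (α * x 0 + β) + -(β * α⁻¹)) ∈ σ
    rw [ar_inv_chart hα]
    exact hx
  have hcomp := IsSemialgebraicFunOn.comp_isSemialgebraicMapOn_holds hf
    (aff_isSemialgebraicMapOn_chart hσ₁ hc hαi) hmaps
  exact (IsSemialgebraicFunOn.mul_holds (isSemialgebraicFunOn_const_of_isAlgebraic hσ₁ hαi)
    hcomp).congr fun u _ => rfl

/-- The pushed-forward integrand `u ↦ α⁻¹ · f(Ψ u)` is absolutely integrable on `Φ(σ)` as soon as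
`f` is on `σ` (`α > 0`): Mathlib's Jacobian criterion along the affine chart `Φ`, injective with
`|det Φ'| = α`, and `α · α⁻¹ · f(Ψ(Φ x)) = f(x)`. [folklore] -/
theorem ar_integrableOn {σ : Set (Fin 1 → ℝ)} {f : (Fin 1 → ℝ) → ℝ} (hσ : IsSemialgebraic ℚ σ)
    (hf : IntegrableOn f σ) {α : ℝ} (hα : 0 < α) (β : ℝ) :
    IntegrableOn (fun u => α⁻¹ * f (fun _ => α⁻¹ * u 0 + -(β * α⁻¹)))
      ((fun y : Fin 1 → ℝ => fun _ : Fin 1 => α * y 0 + β) '' σ) := by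
  have hσm : MeasurableSet σ :=
    Literature.ModelTheory.ExponentialFields.IsSemialgebraic.measurableSet_holds hσ
  refine (integrableOn_image_iff_integrableOn_abs_det_fderiv_smul volume hσm
    (fun x _ => (aff_hasFDerivAt_chart α β x).hasFDerivWithinAt)
    (aff_injective_chart hα.ne' β).injOn _).2 (hf.congr_fun (fun x _ => ?_) hσm)
  show f x = |(α • ContinuousLinearMap.id ℝ (Fin 1 → ℝ)).det| •
    (α⁻¹ * f (fun _ => α⁻¹ * (α * x 0 + β) + -(β * α⁻¹)))
  rw [aff_abs_det_chartDeriv hα, ar_inv_chart hα.ne', smul_eq_mul, ← mul_assoc,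
    mul_inv_cancel₀ hα.ne', one_mul]

/-- **The affine push-forward** of a one-dimensional representation `r = [σ, f]` along
`Φ(t) = α t + β` (`α > 0`, `α, β` real algebraic): the honest representation
`r₁ = [Φ(σ), α⁻¹ · f(α⁻¹ u − β α⁻¹)]` (`ar_isSemialgebraic_image`, `ar_isSemialgebraicFunOn`,
`ar_integrableOn`) satisfies `[r] − [r₁] ∈ KZ.relations` — ONE change of variables
(Kontsevich–Zagier's rule (2), `KZ.changeOfVariablesRel`) from `r` onto `r₁`: `Φ` is a
`ℚ`-semialgebraic map, injective, `Φ' = α • id`, and `f(x) = α⁻¹ f(Ψ(Φ x)) · |det Φ'|` on `σ`.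
[cite: KontsevichZagier2001, §1.2 rule (2)] -/
theorem ar_pushforward (r : KZ.IntegralRep 1) {α β : ℝ} (hα : 0 < α) (hαa : IsAlgebraic ℚ α)
    (hβa : IsAlgebraic ℚ β) :
    ∃ r₁ : KZ.IntegralRep 1,
      r₁.domain = (fun y : Fin 1 → ℝ => fun _ : Fin 1 => α * y 0 + β) '' r.domain ∧
      r₁.integrand = (fun u => α⁻¹ * r.integrand (fun _ => α⁻¹ * u 0 + -(β * α⁻¹))) ∧
      KZ.of r - KZ.of r₁ ∈ KZ.relations := by
  refine ⟨⟨(fun y : Fin 1 → ℝ => fun _ : Fin 1 => α * y 0 + β) '' r.domain,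
    fun u => α⁻¹ * r.integrand (fun _ => α⁻¹ * u 0 + -(β * α⁻¹)),
    ar_isSemialgebraic_image r.isSemialgebraic_domain hαa hβa,
    ar_isSemialgebraicFunOn r.isSemialgebraic_domain r.isSemialgebraicFunOn_integrand hα.ne' hαa hβa,
    ar_integrableOn r.isSemialgebraic_domain r.integrableOn hα β⟩, rfl, rfl, ?_⟩
  -- ONE change of variables `u = α t + β` from `r` onto `r₁`
  refine KZ.changeOfVariablesRel_subset_relations
    ⟨1, r, _, fun y : Fin 1 → ℝ => fun _ : Fin 1 => α * y 0 + β,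
      fun _ => α • ContinuousLinearMap.id ℝ (Fin 1 → ℝ),
      aff_isSemialgebraicMapOn_chart r.isSemialgebraic_domain hβa hαa,
      fun x _ => (aff_hasFDerivAt_chart α β x).hasFDerivWithinAt,
      (aff_injective_chart hα.ne' β).injOn, rfl, fun x _ => ?_, rfl⟩
  show r.integrand x = α⁻¹ * r.integrand (fun _ => α⁻¹ * (α * x 0 + β) + -(β * α⁻¹)) *
    |(α • ContinuousLinearMap.id ℝ (Fin 1 → ℝ)).det|
  rw [aff_abs_det_chartDeriv hα, ar_inv_chart hα.ne', mul_comm, ← mul_assoc,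
    mul_inv_cancel₀ hα.ne', one_mul]

/-- Evaluating at `(t, w)` the substituted polynomial `P(a⁻¹ X₀ − b a⁻¹, X₁)` (`P ∈ K[X₀, X₁]`,
`K = ℚ̄ ∩ ℝ`, `a, b ∈ K`) is evaluating `P` at `(a⁻¹ t − b a⁻¹, w)` (`MvPolynomial.aeval_bind₁`).
[folklore] -/
theorem ar_aeval_bind₁ (a b : algebraicClosure ℚ ℝ) (P : MvPolynomial (Fin 2) (algebraicClosure ℚ ℝ))
    (t w : ℝ) :
    (aeval ![t, w] (bind₁ (![C a⁻¹ * X 0 + C (-(b * a⁻¹)), X 1] :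
        Fin 2 → MvPolynomial (Fin 2) (algebraicClosure ℚ ℝ)) P) : ℝ) =
      aeval ![(a : ℝ)⁻¹ * t + -((b : ℝ) * (a : ℝ)⁻¹), w] P := by
  have hg : (fun i => aeval ![t, w] ((![C a⁻¹ * X 0 + C (-(b * a⁻¹)), X 1] :
      Fin 2 → MvPolynomial (Fin 2) (algebraicClosure ℚ ℝ)) i)) =
      ![(a : ℝ)⁻¹ * t + -((b : ℝ) * (a : ℝ)⁻¹), w] := by
    funext i
    fin_cases i <;> simp
  rw [MvPolynomial.aeval_bind₁, hg]

end SqrtAffineReduce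

/-- **Euler reduction of `ℚ̄(x, √(ax + b))`-integrands** (stub 37 `tateLifting_sqrtAffineReduce`
of the lead's skeleton): a one-dimensional representation `r = [σ, P(x, √(ax+b))/Q(x, √(ax+b))]`
with `a, b ∈ K = ℚ̄ ∩ ℝ`, `a > 0`, `ax + b > 0` on `σ`, `P, Q ∈ K[X₀, X₁]`, `Q(x, √(ax+b)) ≠ 0`
on `σ`, differs by relations from a representation `ρ` whose integrand reads on its domain as
`p(t)/q(t)` with `p, q ∈ ℝ[t]` having real-algebraic coefficients and `q ≠ 0` there: ONE affine
move `u = ax + b` (rule (2), `SqrtAffineReduce.ar_pushforward`) onto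
`r₁ = [Φ(σ), a⁻¹ P(Ψ u, √u)/Q(Ψ u, √u)]`, `Ψ(u) = a⁻¹ u − b a⁻¹`, `Φ(σ) ⊆ (0, ∞)`, followed by the
Euler reduction of `ℚ̄(u, √u)`-integrands (`tateLifting_sqrtReduce`) applied to the substituted
polynomials `a⁻¹ P(a⁻¹ X₀ − b a⁻¹, X₁)`, `Q(a⁻¹ X₀ − b a⁻¹, X₁)`.
[cite: KontsevichZagier2001, §1.2 rule (2)] -/
theorem tateLifting_sqrtAffineReduce :
    ∀ (a b : algebraicClosure ℚ ℝ) (P Q : MvPolynomial (Fin 2) (algebraicClosure ℚ ℝ)) (r : KZ.IntegralRep 1),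
      0 < (a : ℝ) → (∀ x ∈ r.domain, 0 < (a : ℝ) * x 0 + b) →
      (∀ x ∈ r.domain, MvPolynomial.aeval ![x 0, Real.sqrt ((a : ℝ) * x 0 + b)] Q ≠ 0) →
      Set.EqOn r.integrand (fun x => MvPolynomial.aeval ![x 0, Real.sqrt ((a : ℝ) * x 0 + b)] P /
        MvPolynomial.aeval ![x 0, Real.sqrt ((a : ℝ) * x 0 + b)] Q) r.domain →
      ∃ (ρ : KZ.IntegralRep 1) (p q : Polynomial ℝ), (∀ i, IsAlgebraic ℚ (p.coeff i)) ∧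
        (∀ i, IsAlgebraic ℚ (q.coeff i)) ∧ (∀ x ∈ ρ.domain, q.eval (x 0) ≠ 0) ∧
        Set.EqOn ρ.integrand (fun x => p.eval (x 0) / q.eval (x 0)) ρ.domain ∧
        KZ.of r - KZ.of ρ ∈ KZ.relations := by
  intro a b P Q r ha hpos hQ hPQ
  have hαa : IsAlgebraic ℚ (a : ℝ) := mem_algebraicClosure_iff.1 a.2
  have hβa : IsAlgebraic ℚ (b : ℝ) := mem_algebraicClosure_iff.1 b.2
  -- the affine push-forward `r₁` of `r` along `u = a x + b`, `[r] − [r₁] ∈ relations`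
  obtain ⟨r₁, hdom, hint, h01⟩ := SqrtAffineReduce.ar_pushforward r ha hαa hβa
  -- the hypotheses of the Euler reduction of `ℚ̄(u, √u)`-integrands for `r₁`
  have hpos₁ : ∀ u ∈ r₁.domain, 0 < u 0 := by
    rw [hdom]
    rintro _ ⟨x, hx, rfl⟩
    exact hpos x hx
  have hQ₁ : ∀ u ∈ r₁.domain, (aeval ![u 0, Real.sqrt (u 0)]
      (bind₁ (![C a⁻¹ * X 0 + C (-(b * a⁻¹)), X 1] :
        Fin 2 → MvPolynomial (Fin 2) (algebraicClosure ℚ ℝ)) Q) : ℝ) ≠ 0 := by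
    rw [hdom]
    rintro _ ⟨x, hx, rfl⟩
    show (aeval ![(a : ℝ) * x 0 + b, Real.sqrt ((a : ℝ) * x 0 + b)]
      (bind₁ (![C a⁻¹ * X 0 + C (-(b * a⁻¹)), X 1] :
        Fin 2 → MvPolynomial (Fin 2) (algebraicClosure ℚ ℝ)) Q) : ℝ) ≠ 0
    rw [SqrtAffineReduce.ar_aeval_bind₁, SqrtAffineReduce.ar_inv_chart_apply ha.ne']
    exact hQ x hx
  have hPQ₁ : Set.EqOn r₁.integrand (fun u => (aeval ![u 0, Real.sqrt (u 0)]
      (C a⁻¹ * bind₁ (![C a⁻¹ * X 0 + C (-(b * a⁻¹)), X 1] :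
        Fin 2 → MvPolynomial (Fin 2) (algebraicClosure ℚ ℝ)) P) : ℝ) /
      aeval ![u 0, Real.sqrt (u 0)]
        (bind₁ (![C a⁻¹ * X 0 + C (-(b * a⁻¹)), X 1] :
          Fin 2 → MvPolynomial (Fin 2) (algebraicClosure ℚ ℝ)) Q)) r₁.domain := by
    rw [hdom, hint]
    rintro _ ⟨x, hx, rfl⟩
    have hx' : r.integrand x = aeval ![x 0, Real.sqrt ((a : ℝ) * x 0 + b)] P /
        aeval ![x 0, Real.sqrt ((a : ℝ) * x 0 + b)] Q := hPQ hx
    show (a : ℝ)⁻¹ * r.integrand (fun _ => (a : ℝ)⁻¹ * ((a : ℝ) * x 0 + b) + -((b : ℝ) * (a : ℝ)⁻¹)) =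
      aeval ![(a : ℝ) * x 0 + b, Real.sqrt ((a : ℝ) * x 0 + b)]
          (C a⁻¹ * bind₁ (![C a⁻¹ * X 0 + C (-(b * a⁻¹)), X 1] :
            Fin 2 → MvPolynomial (Fin 2) (algebraicClosure ℚ ℝ)) P) /
        aeval ![(a : ℝ) * x 0 + b, Real.sqrt ((a : ℝ) * x 0 + b)]
          (bind₁ (![C a⁻¹ * X 0 + C (-(b * a⁻¹)), X 1] :
            Fin 2 → MvPolynomial (Fin 2) (algebraicClosure ℚ ℝ)) Q)
    rw [map_mul, MvPolynomial.aeval_C, IntermediateField.algebraMap_apply,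
      IntermediateField.coe_inv, SqrtAffineReduce.ar_aeval_bind₁, SqrtAffineReduce.ar_aeval_bind₁,
      SqrtAffineReduce.ar_inv_chart ha.ne', SqrtAffineReduce.ar_inv_chart_apply ha.ne', hx',
      mul_div_assoc]
  -- Euler's reduction on `r₁`, and the two relations chained
  obtain ⟨ρ, p, q, hp, hq, hq0, hρ, h12⟩ := tateLifting_sqrtReduce _ _ r₁ hpos₁ hQ₁ hPQ₁
  refine ⟨ρ, p, q, hp, hq, hq0, hρ, ?_⟩
  have h := KZ.relations.add_mem h01 h12
  rwa [sub_add_sub_cancel] at h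

end Summit.KontsevichZagierPeriods.InverseLandau

end
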